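import Mathlib
import Summits.RiemannHypothesis.RiemannHypothesis.Theorems.Splittings.SlidingTheftGerm

/-!
# Removal-only exact theft is impossible for finite off-line configurations (`KreinFailsFinite`)

(Part A of 2 — §§1–3: moments / node polynomial / algebraic core, finite exponential sums, the two traces; part B =
`PrimeWindowBlindnessKrein.lean` — §§4–5: window ⇒ moments, `kreinFailsFinite`, controls.  Carved at the §3/§4 boundary
by the filer for the gate's 400-line limit; bytes otherwise the author's.)

Support (helper) instrument of the screw / prime-window-blindness lane (cell rh-split, seat rh-split-screw-bridge
g19; statement of record = theory-1's 25.12 (B) / K6-SPEC `976594e97f27ce99`; keyed by lead RULINGS #491/#493).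
It decides, for FINITE configurations, clause 1 «REMOVAL-ONLY: NO» of the question Q_C recorded (and expressly
NOT asserted) in `PrimeWindowBlindnessBarrierHolds` (#812): no finite strictly off-line configuration `Z` has
its trace `Ψ_Z(t) = Σ quadTerm` reproduced EXACTLY on a window `|t| < U` by the trace `Σ_k n_k·pairTrace g_k`
of finitely many REMOVED on-line pairs with multiplicities `n_k ≥ 0` (`kreinFailsFinite`,
`removalOnlyTheftNoGoFinite_holds`).

Mechanism (Hamburger / Krein reading, theory-1 K6-SPEC §0): the even derivatives at `0` of both traces are
moment sequences — `Ψ^{(2N+2)}(0) = Σ_a 2m_a (z_a^N + z̄_a^N)` with nodes `z_a = κ_a² ∉ ℝ`, and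
`f^{(2N+2)}(0) = Σ_k 2n_k (−g_k²)^N` with REAL nodes and nonnegative weights.  The node polynomial
`P_Z = Π_a (X² − 2Re z_a·X + |z_a|²)` is positive on `ℝ` and killed by the first functional; applied to the
second it forces every `n_k = 0`, and then the order-`0` identity `4Σ m_a = 0` is absurd
(`kreinFailsFinite_moments`, §1).  §2–§3 supply the finite bridge «window equality ⇒ all moments agree» by
writing both traces as finite exponential sums `Σ_p A_p e^{B_p t}`, a family closed under `d/dt`, so that
equality on an open window propagates to every derivative (`Filter.EventuallyEq.deriv_eq`) and hence to the
exponential moments at `t = 0` (`momentMatch_of_window`).  §4 assembles the theorem over the tree's `Config`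
and records it as a closed `Prop` in the vocabulary of #812; §5 is the kernel negative control: an ON-LINE atom
`κ = ig` IS exactly compensated (`quadTerm m (g·I) = 2m·pairTrace g`), so the off-line hypothesis is the one
that bites.

NOT decided here (paper / later kernel): the countable-removal bridge (`HasSum` cosine series, Lukacs-type moment
lemma — theory-1 K6-SPEC §4), B33 clause 3 (existence of a removal-AND-slide exact theft, K7′), anything with
integrality of multiplicities.  Elementary; ζ-free and RH-free; nothing here bears on the truth of RH.
-/

set_option linter.dupNamespace false

namespace Summit.RiemannHypothesis.RiemannHypothesis.Theorems.Splittings.PrimeWindowBlindnessKrein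

open Polynomial
open Summit.RiemannHypothesis.RiemannHypothesis.Theorems.Splittings.ScrewLatticeTower
open Summit.RiemannHypothesis.RiemannHypothesis.Theorems.Splittings.ScrewLatticeWolff (quadTerm)
open Summit.RiemannHypothesis.RiemannHypothesis.Theorems.Splittings.SlidingGerm (pairTrace)

variable {α β : Type*}

/-! ## 1. Moments, the node polynomial, and the algebraic core -/


/-- OFF-LINE EVEN MOMENTS of a finite family of atoms `(m_a, κ_a)` with nodes `z_a = κ_a²`:
`M_N = Σ_a 2 m_a (z_a^N + z̄_a^N)` (`= Ψ^{(2N+2)}(0)` for `Ψ = Σ_a quadTerm m_a κ_a`; real, written in `ℂ`). -/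
noncomputable def offMoment (s : Finset α) (m : α → ℝ) (κ : α → ℂ) (N : ℕ) : ℂ :=
  ∑ a ∈ s, 2 * (m a : ℂ) * ((κ a ^ 2) ^ N + ((starRingEnd ℂ) (κ a) ^ 2) ^ N)

/-- REMOVAL MOMENTS of finitely many on-line pairs (multiplicities `n_k`, heights `g_k`; nodes `−g_k²`):
`Σ_k 2 n_k (−g_k²)^N` (`= f^{(2N+2)}(0)` for the removal trace `f = Σ_k n_k · pairTrace g_k`). -/
noncomputable def remMoment (r : Finset ℕ) (n g : ℕ → ℝ) (N : ℕ) : ℝ :=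
  ∑ k ∈ r, 2 * n k * (-(g k ^ 2)) ^ N

/-- MOMENT MATCH up to order `N₀` (Hamburger data at `t = 0`): `M_N = Σ_k 2 n_k (−g_k²)^N` for all `N ≤ N₀`. -/
def MomentMatch (s : Finset α) (m : α → ℝ) (κ : α → ℂ) (r : Finset ℕ) (n g : ℕ → ℝ) (N₀ : ℕ) : Prop :=
  ∀ N ≤ N₀, offMoment s m κ N = (remMoment r n g N : ℂ)

/-- The NODE POLYNOMIAL `P_Z = Π_a (X² − 2 Re(z_a) X + |z_a|²) ∈ ℝ[X]`, `z_a = κ_a²` (theory-1 K6-SPEC §0 (Q2)). -/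
noncomputable def nodePoly (s : Finset α) (κ : α → ℂ) : ℝ[X] :=
  ∏ a ∈ s, (X ^ 2 - C (2 * (κ a ^ 2).re) * X + C (Complex.normSq (κ a ^ 2)))

/-- `P_Z > 0` on `ℝ` when no node is real: each factor is `(x − Re z)² + (Im z)²`. -/
theorem nodePoly_eval_pos (s : Finset α) (κ : α → ℂ) (hκ : ∀ a ∈ s, (κ a ^ 2).im ≠ 0) (x : ℝ) :
    0 < (nodePoly s κ).eval x := by
  unfold nodePoly
  rw [eval_prod]
  refine Finset.prod_pos fun a ha ↦ ?_
  simp only [eval_add, eval_sub, eval_pow, eval_X, eval_mul, eval_C]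
  have h := hκ a ha
  have e : x ^ 2 - 2 * (κ a ^ 2).re * x + Complex.normSq (κ a ^ 2)
      = (x - (κ a ^ 2).re) ^ 2 + (κ a ^ 2).im ^ 2 := by
    rw [Complex.normSq_apply]; ring
  rw [e]
  have : 0 < (κ a ^ 2).im ^ 2 := by positivity
  nlinarith [sq_nonneg (x - (κ a ^ 2).re)]

/-- The quadratic factor of `z` vanishes at `z` and at `z̄`. -/
theorem quadFactor_aeval_eq_zero (z w : ℂ) (hw : w = z ∨ w = (starRingEnd ℂ) z) :
    aeval w (X ^ 2 - C (2 * z.re) * X + C (Complex.normSq z) : ℝ[X]) = 0 := by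
  simp only [map_add, map_sub, map_pow, aeval_X, map_mul, aeval_C, Complex.coe_algebraMap]
  have h1 : ((Complex.normSq z : ℝ) : ℂ) = z * (starRingEnd ℂ) z := (Complex.mul_conj z).symm
  have h2 : ((2 : ℝ) : ℂ) * (z.re : ℂ) = z + (starRingEnd ℂ) z := by
    rw [Complex.add_conj z]; push_cast; ring
  rw [h1, h2]
  rcases hw with rfl | rfl <;> ring

/-- `P_Z(z_a) = 0`. -/
theorem nodePoly_aeval_eq_zero (s : Finset α) (κ : α → ℂ) {a : α} (ha : a ∈ s) :
    aeval (κ a ^ 2) (nodePoly s κ) = 0 := by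
  unfold nodePoly
  rw [map_prod]
  exact Finset.prod_eq_zero ha (quadFactor_aeval_eq_zero _ _ (Or.inl rfl))

/-- `P_Z(z̄_a) = 0`. -/
theorem nodePoly_aeval_conj_eq_zero (s : Finset α) (κ : α → ℂ) {a : α} (ha : a ∈ s) :
    aeval ((starRingEnd ℂ) (κ a) ^ 2) (nodePoly s κ) = 0 := by
  unfold nodePoly
  rw [map_prod]
  refine Finset.prod_eq_zero ha (quadFactor_aeval_eq_zero _ _ (Or.inr ?_))
  simp [map_pow]

/-- `deg P_Z ≤ 2·#atoms`. -/
theorem natDegree_nodePoly_le (s : Finset α) (κ : α → ℂ) : (nodePoly s κ).natDegree ≤ 2 * s.card := by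
  unfold nodePoly
  refine (natDegree_prod_le _ _).trans ?_
  rw [Finset.card_eq_sum_ones, Finset.mul_sum]
  refine Finset.sum_le_sum fun a _ ↦ ?_
  simp only [mul_one]
  compute_degree

/-- **(K6b, algebraic core) `kreinFailsFinite_moments` — theory-1 25.12 (B) / K6-SPEC §3.**  Atoms with weights
`m_a ≥ 0`, not all zero, and nodes `κ_a²` OFF the real axis (`Im κ_a² ≠ 0`, i.e. `Re κ_a ≠ 0 ≠ Im κ_a`); removal
multiplicities `n_k ≥ 0`.  Then the moments cannot match up to order `2·#atoms`: the node polynomial `P_Z` is `> 0`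
on `ℝ` and is killed by the off-line functional (`Σ_N p_N M_N = Σ_a 2m_a (P_Z(z_a) + P_Z(z̄_a)) = 0`), while the
removal side gives `Σ_k 2 n_k P_Z(−g_k²) ≥ 0` with equality only if every `n_k = 0` — and then the order-`0`
identity reads `4 Σ_a m_a = 0`.  (The hypothesis that bites is `Im κ² ≠ 0`: with a real node the moments of one
on-line pair DO match.) -/
theorem kreinFailsFinite_moments (s : Finset α) (m : α → ℝ) (κ : α → ℂ) (r : Finset ℕ) (n g : ℕ → ℝ)
    (hm : ∀ a ∈ s, 0 ≤ m a) (hpos : ∃ a ∈ s, 0 < m a) (hκ : ∀ a ∈ s, (κ a ^ 2).im ≠ 0)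
    (hn : ∀ k ∈ r, 0 ≤ n k) : ¬ MomentMatch s m κ r n g (2 * s.card) := by
  classical
  intro hMM
  set P := nodePoly s κ with hP
  set D := 2 * s.card + 1 with hD
  have hdeg : P.natDegree < D := Nat.lt_succ_of_le (natDegree_nodePoly_le s κ)
  -- apply the functional `p ↦ Σ_N p_N · (moment N)` to `P` on both sides
  have key : ∑ N ∈ Finset.range D, (P.coeff N : ℂ) * offMoment s m κ N
      = ∑ N ∈ Finset.range D, (P.coeff N : ℂ) * (remMoment r n g N : ℂ) :=
    Finset.sum_congr rfl fun N hN ↦ by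
      rw [hMM N (Nat.lt_succ_iff.mp (Finset.mem_range.mp hN))]
  -- off-line side: `Σ_a 2 m_a (P(z_a) + P(z̄_a)) = 0`
  have hL : ∑ N ∈ Finset.range D, (P.coeff N : ℂ) * offMoment s m κ N = 0 := by
    simp only [offMoment, Finset.mul_sum]
    rw [Finset.sum_comm]
    refine Finset.sum_eq_zero fun a ha ↦ ?_
    have e1 : aeval (κ a ^ 2) P = ∑ N ∈ Finset.range D, (P.coeff N : ℂ) * (κ a ^ 2) ^ N := by
      rw [aeval_eq_sum_range' hdeg]
      exact Finset.sum_congr rfl fun N _ ↦ by rw [Algebra.smul_def]; rfl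
    have e2 : aeval ((starRingEnd ℂ) (κ a) ^ 2) P
        = ∑ N ∈ Finset.range D, (P.coeff N : ℂ) * ((starRingEnd ℂ) (κ a) ^ 2) ^ N := by
      rw [aeval_eq_sum_range' hdeg]
      exact Finset.sum_congr rfl fun N _ ↦ by rw [Algebra.smul_def]; rfl
    have z1 : aeval (κ a ^ 2) P = 0 := nodePoly_aeval_eq_zero s κ ha
    have z2 : aeval ((starRingEnd ℂ) (κ a) ^ 2) P = 0 := nodePoly_aeval_conj_eq_zero s κ ha
    calc ∑ N ∈ Finset.range D,
          (P.coeff N : ℂ) * (2 * (m a : ℂ) * ((κ a ^ 2) ^ N + ((starRingEnd ℂ) (κ a) ^ 2) ^ N))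
        = 2 * (m a : ℂ) * (∑ N ∈ Finset.range D, (P.coeff N : ℂ) * (κ a ^ 2) ^ N
            + ∑ N ∈ Finset.range D, (P.coeff N : ℂ) * ((starRingEnd ℂ) (κ a) ^ 2) ^ N) := by
          rw [← Finset.sum_add_distrib, Finset.mul_sum]
          exact Finset.sum_congr rfl fun N _ ↦ by ring
      _ = 0 := by rw [← e1, ← e2, z1, z2]; ring
  -- removal side: `Σ_k 2 n_k P(−g_k²)`
  have hR : ∑ N ∈ Finset.range D, (P.coeff N : ℂ) * (remMoment r n g N : ℂ)
      = ((∑ k ∈ r, 2 * n k * P.eval (-(g k ^ 2)) : ℝ) : ℂ) := by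
    have hreal : ∑ N ∈ Finset.range D, P.coeff N * remMoment r n g N
        = ∑ k ∈ r, 2 * n k * P.eval (-(g k ^ 2)) := by
      simp only [remMoment, Finset.mul_sum]
      rw [Finset.sum_comm]
      refine Finset.sum_congr rfl fun k _ ↦ ?_
      rw [eval_eq_sum_range' hdeg, Finset.mul_sum]
      exact Finset.sum_congr rfl fun N _ ↦ by ring
    rw [← hreal]
    push_cast
    rfl
  have hsum0 : ∑ k ∈ r, 2 * n k * P.eval (-(g k ^ 2)) = 0 := by
    have := key
    rw [hL, hR] at this
    exact_mod_cast this.symm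
  -- every removal multiplicity vanishes
  have hterm : ∀ k ∈ r, 0 ≤ 2 * n k * P.eval (-(g k ^ 2)) := fun k hk ↦
    mul_nonneg (by linarith [hn k hk]) (nodePoly_eval_pos s κ hκ _).le
  have hnk : ∀ k ∈ r, n k = 0 := by
    intro k hk
    have h0 := (Finset.sum_eq_zero_iff_of_nonneg hterm).mp hsum0 k hk
    have hPk := nodePoly_eval_pos s κ hκ (-(g k ^ 2))
    rcases mul_eq_zero.mp h0 with h | h
    · linarith
    · exact absurd h hPk.ne'
  -- the order-0 identity: `4 Σ m_a = Σ 2 n_k = 0`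
  have h0 := hMM 0 (Nat.zero_le _)
  have hrem0 : remMoment r n g 0 = 0 := by
    simp only [remMoment, pow_zero, mul_one]
    exact Finset.sum_eq_zero fun k hk ↦ by rw [hnk k hk]; ring
  rw [hrem0] at h0
  have hoff0 : offMoment s m κ 0 = ((∑ a ∈ s, 4 * m a : ℝ) : ℂ) := by
    simp only [offMoment, pow_zero]
    push_cast
    exact Finset.sum_congr rfl fun a _ ↦ by ring
  rw [hoff0] at h0
  have hms : ∑ a ∈ s, 4 * m a = 0 := by exact_mod_cast h0
  obtain ⟨a, ha, hma⟩ := hpos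
  have := (Finset.sum_eq_zero_iff_of_nonneg (fun a ha ↦ by linarith [hm a ha])).mp hms a ha
  linarith



/-! ## 2. Finite exponential sums: closed under `d/dt`, so window equality propagates to all moments -/

/-- A finite exponential sum `t ↦ Σ_{p ∈ s} A_p e^{B_p t}` of the real variable `t`. -/
noncomputable def finExpSum (s : Finset β) (A B : β → ℂ) (t : ℝ) : ℂ :=
  ∑ p ∈ s, A p * Complex.exp (B p * t)

/-- Finite exponential sums are closed under `d/dt`: the derivative of `Σ A_p e^{B_p t}` is `Σ (A_p B_p) e^{B_p t}`. -/
theorem hasDerivAt_finExpSum (s : Finset β) (A B : β → ℂ) (t : ℝ) :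
    HasDerivAt (finExpSum s A B) (finExpSum s (fun p ↦ A p * B p) B t) t := by
  have h : ∀ p ∈ s, HasDerivAt (fun t : ℝ ↦ A p * Complex.exp (B p * t))
      (A p * B p * Complex.exp (B p * t)) t := by
    intro p _
    have h1 : HasDerivAt (fun t : ℝ ↦ B p * (t : ℂ)) (B p) t := by
      simpa using ((hasDerivAt_id t).ofReal_comp).const_mul (B p)
    exact ((h1.cexp).const_mul (A p)).congr_deriv (by ring)
  show HasDerivAt (fun t : ℝ ↦ ∑ p ∈ s, A p * Complex.exp (B p * t))
    (∑ p ∈ s, A p * B p * Complex.exp (B p * t)) t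
  exact HasDerivAt.fun_sum h

/-- At `t = 0` a finite exponential sum is the plain coefficient sum `Σ A_p`. -/
theorem finExpSum_zero (s : Finset β) (A B : β → ℂ) : finExpSum s A B 0 = ∑ p ∈ s, A p := by
  simp [finExpSum]

/-- If two finite exponential sums agree on the window `|t| < U` (`U > 0` not even needed pointwise), so do the
sums with coefficients `A_p B_p^n` (their `n`-th derivatives), for every `n`. -/
theorem finExpSum_pow_eq_of_window {γ : Type*} {U : ℝ} {s : Finset β} {s' : Finset γ} {A B : β → ℂ}
    {A' B' : γ → ℂ} (h : ∀ t : ℝ, |t| < U → finExpSum s A B t = finExpSum s' A' B' t) (n : ℕ) :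
    ∀ t : ℝ, |t| < U →
      finExpSum s (fun p ↦ A p * B p ^ n) B t = finExpSum s' (fun p ↦ A' p * B' p ^ n) B' t := by
  induction n with
  | zero => simpa using h
  | succ n ih =>
    intro t ht
    have htI : t ∈ Set.Ioo (-U) U := ⟨(abs_lt.mp ht).1, (abs_lt.mp ht).2⟩
    have hev : (finExpSum s (fun p ↦ A p * B p ^ n) B) =ᶠ[nhds t]
        (finExpSum s' (fun p ↦ A' p * B' p ^ n) B') :=
      Filter.eventuallyEq_of_mem (Ioo_mem_nhds htI.1 htI.2)
        fun x hx ↦ ih x (abs_lt.mpr ⟨hx.1, hx.2⟩)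
    have hd := hev.deriv_eq
    rw [(hasDerivAt_finExpSum s _ B t).deriv, (hasDerivAt_finExpSum s' _ B' t).deriv] at hd
    have e1 : (fun p ↦ A p * B p ^ (n + 1)) = fun p ↦ A p * B p ^ n * B p := funext fun p ↦ by ring
    have e2 : (fun p ↦ A' p * B' p ^ (n + 1)) = fun p ↦ A' p * B' p ^ n * B' p :=
      funext fun p ↦ by ring
    rw [e1, e2]
    exact hd

/-- Window equality of two finite exponential sums forces equality of all exponential moments
`Σ_p A_p B_p^n = Σ_p A'_p B'_p^n`. -/
theorem expMoment_eq_of_window {γ : Type*} {U : ℝ} (hU : 0 < U) {s : Finset β} {s' : Finset γ}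
    {A B : β → ℂ} {A' B' : γ → ℂ} (h : ∀ t : ℝ, |t| < U → finExpSum s A B t = finExpSum s' A' B' t)
    (n : ℕ) : ∑ p ∈ s, A p * B p ^ n = ∑ p ∈ s', A' p * B' p ^ n := by
  have := finExpSum_pow_eq_of_window h n 0 (by simpa using hU)
  rwa [finExpSum_zero, finExpSum_zero] at this

/-! ## 3. The two traces as finite exponential sums -/

/-- Coefficients of the six exponential pieces of one off-line atom `quadTerm m κ`. -/
noncomputable def offA (m : ℝ) (κ : ℂ) : Fin 6 → ℂ :=
  ![m / κ ^ 2, m / κ ^ 2, -(2 * m / κ ^ 2), m / (starRingEnd ℂ) κ ^ 2, m / (starRingEnd ℂ) κ ^ 2,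
    -(2 * m / (starRingEnd ℂ) κ ^ 2)]

/-- Exponents of the six exponential pieces of one off-line atom: `±κ, 0, ±κ̄, 0`. -/
noncomputable def offB (κ : ℂ) : Fin 6 → ℂ :=
  ![κ, -κ, 0, (starRingEnd ℂ) κ, -(starRingEnd ℂ) κ, 0]

/-- Coefficients of the three exponential pieces of one removed on-line pair `n · pairTrace g`. -/
noncomputable def remA (n g : ℝ) : Fin 3 → ℂ :=
  ![2 * n / (g : ℂ) ^ 2, -((n : ℂ) / (g : ℂ) ^ 2), -((n : ℂ) / (g : ℂ) ^ 2)]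

/-- Exponents of the three exponential pieces of one removed on-line pair: `0, ±i g`. -/
noncomputable def remB (g : ℝ) : Fin 3 → ℂ :=
  ![0, (g : ℂ) * Complex.I, -((g : ℂ) * Complex.I)]

/-- `quadTerm m κ t = 4m·Re[(cosh κt − 1)/κ²]` is the six-piece exponential sum. -/
theorem quadTerm_eq_finExpSum (m : ℝ) {κ : ℂ} (hκ : κ ≠ 0) (t : ℝ) :
    (quadTerm m κ t : ℂ) = ∑ j : Fin 6, offA m κ j * Complex.exp (offB κ j * t) := by
  have hκ' : (starRingEnd ℂ) κ ≠ 0 := (_root_.map_ne_zero _).mpr hκ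
  unfold quadTerm
  push_cast
  rw [Complex.re_eq_add_conj]
  have hc : (starRingEnd ℂ) ((Complex.cosh (κ * t) - 1) / κ ^ 2)
      = (Complex.cosh ((starRingEnd ℂ) κ * t) - 1) / (starRingEnd ℂ) κ ^ 2 := by
    rw [map_div₀, map_sub, map_one, map_pow, ← Complex.cosh_conj, map_mul, Complex.conj_ofReal]
  rw [hc]
  have h1 : Complex.cosh (κ * t) = (Complex.exp (κ * t) + Complex.exp (-(κ * t))) / 2 := by
    rw [← Complex.two_cosh]; ring
  have h2 : Complex.cosh ((starRingEnd ℂ) κ * t)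
      = (Complex.exp ((starRingEnd ℂ) κ * t) + Complex.exp (-((starRingEnd ℂ) κ * t))) / 2 := by
    rw [← Complex.two_cosh]; ring
  rw [h1, h2]
  simp only [Fin.sum_univ_six, offA, offB, Matrix.cons_val]
  simp only [neg_mul, zero_mul, Complex.exp_zero, mul_one]
  field_simp
  ring

/-- `n · pairTrace g t = 2n(1 − cos gt)/g²` is the three-piece exponential sum. -/
theorem pairTrace_eq_finExpSum (n : ℝ) {g : ℝ} (hg : g ≠ 0) (t : ℝ) :
    ((n * pairTrace g t : ℝ) : ℂ) = ∑ j : Fin 3, remA n g j * Complex.exp (remB g j * t) := by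
  have hg' : (g : ℂ) ≠ 0 := Complex.ofReal_ne_zero.mpr hg
  unfold pairTrace
  push_cast
  have h1 : Complex.cos ((g : ℂ) * t)
      = (Complex.exp ((g : ℂ) * t * Complex.I) + Complex.exp (-((g : ℂ) * t) * Complex.I)) / 2 := by
    rw [← Complex.two_cos]; ring
  rw [h1]
  simp only [Fin.sum_univ_three, remA, remB, Matrix.cons_val]
  simp only [neg_mul, zero_mul, Complex.exp_zero, mul_one]
  rw [show (g : ℂ) * Complex.I * t = (g : ℂ) * t * Complex.I by ring]
  field_simp
  ring

/-- Exponential moments of one off-line atom at order `2N+2`: `2m((κ²)^N + (κ̄²)^N)`. -/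
theorem offA_mul_offB_pow (m : ℝ) {κ : ℂ} (hκ : κ ≠ 0) (N : ℕ) :
    ∑ j : Fin 6, offA m κ j * offB κ j ^ (2 * N + 2)
      = 2 * (m : ℂ) * ((κ ^ 2) ^ N + ((starRingEnd ℂ) κ ^ 2) ^ N) := by
  have hκ' : (starRingEnd ℂ) κ ≠ 0 := (_root_.map_ne_zero _).mpr hκ
  have hne : 2 * N + 2 ≠ 0 := by omega
  have e1 : (-κ) ^ (2 * N + 2) = κ ^ (2 * N + 2) := Even.neg_pow ⟨N + 1, by ring⟩ κ
  have e2 : (-(starRingEnd ℂ) κ) ^ (2 * N + 2) = (starRingEnd ℂ) κ ^ (2 * N + 2) :=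
    Even.neg_pow ⟨N + 1, by ring⟩ _
  simp only [Fin.sum_univ_six, offA, offB, Matrix.cons_val]
  simp only [zero_pow hne, mul_zero, add_zero, e1, e2]
  field_simp
  ring

/-- Exponential moments of one removed on-line pair at order `2N+2`: `2n(−g²)^N`. -/
theorem remA_mul_remB_pow (n : ℝ) {g : ℝ} (hg : g ≠ 0) (N : ℕ) :
    ∑ j : Fin 3, remA n g j * remB g j ^ (2 * N + 2) = ((2 * n * (-(g ^ 2)) ^ N : ℝ) : ℂ) := by
  have hg' : (g : ℂ) ≠ 0 := Complex.ofReal_ne_zero.mpr hg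
  have hne : 2 * N + 2 ≠ 0 := by omega
  have e1 : (-((g : ℂ) * Complex.I)) ^ (2 * N + 2) = ((g : ℂ) * Complex.I) ^ (2 * N + 2) :=
    Even.neg_pow ⟨N + 1, by ring⟩ _
  have e2 : ((g : ℂ) * Complex.I) ^ (2 * N + 2) = -(((g : ℂ) ^ 2) ^ N * (g : ℂ) ^ 2 * (-1) ^ N) := by
    rw [mul_pow, show 2 * N + 2 = 2 * (N + 1) by ring, pow_mul, pow_mul, Complex.I_sq, pow_succ, pow_succ]
    ring
  simp only [Fin.sum_univ_three, remA, remB, Matrix.cons_val]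
  simp only [zero_pow hne, mul_zero, zero_add, e1, e2]
  push_cast
  rw [neg_pow ((g : ℂ) ^ 2) N]
  field_simp
  ring

end Summit.RiemannHypothesis.RiemannHypothesis.Theorems.Splittings.PrimeWindowBlindnessKrein
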